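import Literature.NumberTheory.Sieve.BombieriFriedlanderIwaniecTheorem5Poisson
import Literature.NumberTheory.Sieve.BombieriFriedlanderIwaniecSiegelWalfisz
import HarnessLib

/-!
# Bombieri–Friedlander–Iwaniec 1986, Theorem 5 — step 3: separation of variables, Cauchy's inequality, and `𝓔`

Topic `Literature/NumberTheory/Sieve`; third file of the formalisation of the provable part of the
proof of Theorem 5 of E. Bombieri, J. B. Friedlander, H. Iwaniec, *Primes in arithmetic
progressions to large moduli*, Acta Math. 156 (1986), 203–251, §12 (pp. 235–237), continuing
`BombieriFriedlanderIwaniecTheorem5Weights` (smoothing, (12.1)) and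
`BombieriFriedlanderIwaniecTheorem5Poisson` (Poisson summation per modulus).  Everything here is
PROVED; no named facts are introduced.

BFI, p. 236: "In order to separate the variables in `α̂` we write
`α̂(h/qr) = q ∫ α(ξq) e(ξh/r) dξ` giving `𝒟 ≪ ‖β‖M^{1/2}x^{1/2−ε/2} + x^{2ε} R H⁻¹ ∑_q ∑_n |β_n|
|∑_{1≤h≤H} ∑_{r∼R,(r,a)=1} (δ_r/r) e(ξh/r) e(−ahn̄/qr)|` with some real `ξ`. Hence by Cauchy's
inequality `𝒟 ≪ ‖β‖M^{1/2}x^{1/2−ε/2} + ‖β‖ x^ε M Q^{−1/2} R⁻¹ 𝓔^{1/2}(2Q, 2N, H, 2R)` (12.2) where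
`𝓔(C,D,H,R) = ∑_{c≤C} ∑_{d≤D} |∑_{h≤H} ∑_{r≤R} δ(h,r) e(ah d̄/(cr))|²` with `|δ(h,r)| ≤ 1`."

## Contents

* `BFI.dispE a C D H R δ` — BFI's sum `𝓔(C, D, H, R)` for the residue `a` and coefficients `δ(h,r)`
  (the phase `e(ah d̄/(cr))` written `e(h·(a d̄ mod cr)/(cr))`; terms with `(d, cr) > 1` absent, as
  in the source's convention on `d̄`); `BFI.innerE`, `BFI.dispE_eq`.
  SIGNS: with Mathlib's `𝓕f(ξ) = ∫ f e(−tξ)` the Poisson expansion of `…Theorem5Poisson` produces the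
  phase `e(+h·(a n̄)/(qr))` (`BFI.twCoef`, `BFI.oscSum` at `c = a n̄`), which is BFI's
  `e(−ah n̄/qr)` after `h ↦ −h`; the positive-frequency half `BFI.mainPlus` (terms `h ≥ 1`) is
  therefore compared with `𝓔` for the residue `+a` exactly as defined here, and the other half is
  its complex conjugate (`BFI.mainTerm_eq`).  No sign has to be rediscovered downstream: Lemma 9 is
  quoted for all `a ≠ 0`.
* `BFI.fcoef_mul_eq_integral` — separation of variables `𝓕α(h/(qr)) = q ∫ e(−ξh/r) α(qξ) dξ`.
* `BFI.mainTerm`, `BFI.mainPlus` (the main term after Poisson, and its half `h ≥ 1`),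
  `BFI.mainTerm_eq` (`mainTerm = mainPlus + conj mainPlus`, as `α`, `β`, `γ`, `δ` are real),
  `BFI.norm_dispDw_bump_sub_mainTerm_le` (summing `norm_bracketW_bump_sub_le` over the moduli).
* `BFI.Gsum` (the kernel `G(q,n,ξ)` multiplying `α(qξ)`; `BFI.dyadic_subset_Icc` is reused from
  `BombieriFriedlanderIwaniecSiegelWalfisz`), `BFI.mainPlus_row_eq` (the main term as
  `∑_n γ_q β_n ∫ α(qξ) G(q,n,ξ) dξ`), `BFI.deltaXi` (the coefficients `δ_ξ(h,r) = (R/T)(δ_r/r)e(−ξh/r)`,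
  `|δ_ξ| ≤ 1` by `BFI.norm_deltaXi_le_one`), `BFI.Gsum_eq` and `BFI.sum_norm_sq_Gsum_le`
  (`∑_{q∼Q,n∼N} |G|² ≤ (T/R)² 𝓔(2Q,2N,H₀,2R; δ_ξ)`), and **`BFI.norm_mainPlus_le`**: uniformly in
  `ξ`, pointwise Cauchy–Schwarz in `(q, n)` under the integral over `ξ ∈ [(M−Y)/2Q, (2M+Y)/Q]`
  gives `‖mainPlus‖ ≤ (3M/Q)(∑γ_q² ‖β‖²)^{1/2} (T/R) E^{1/2}` whenever `𝓔(…; δ_ξ) ≤ E` for all `ξ`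
  (BFI's "with some real `ξ`" made rigorous by integrating the pointwise bound).
* **`BFI.abs_dispD_one_le_structural`** — the three steps combined: an explicit inequality
  `|𝒟(M,N,Q,R; α≡1)| ≤ smoothing + Poisson/coprimality errors + 2(3M/Q)(∑γ²‖β‖²)^{1/2}(T/R)E^{1/2}`
  valid for all admissible parameters `Y, H₀, j, K, D₀, T, E`.  Choosing them as powers of `x`
  ((12.2) proper) and inserting Lemma 9 for `E` is the assembly, in the next file.

## References

* E. Bombieri, J. B. Friedlander, H. Iwaniec, Acta Math. 156 (1986), 203–251, §12 (12.2) p. 236,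
  Notations p. 204. [BombieriFriedlanderIwaniecActa1986]
-/

noncomputable section

open Finset Real MeasureTheory
open scoped ArithmeticFunction.sigma ContDiff FourierTransform

namespace Literature.NumberTheory.Sieve

namespace BFI

/-- **BFI's exponential sum `𝓔(C, D, H, R)`** (p. 236):
`𝓔 = ∑_{1≤c≤C} ∑_{1≤d≤D} |∑_{1≤h≤H} ∑_{1≤r≤R, (d,cr)=1} δ(h, r) e(a h d̄/(cr))|²`, where `d̄ d ≡ 1 (mod cr)`
(BFI, Notations p. 204: "`d̄/c` means `a/c` where `ad ≡ 1 (mod c)`"; the terms with `(d, cr) > 1`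
are absent), for arbitrary complex coefficients `δ(h, r)`; the phase is written
`e(h ρ/(cr))` with `ρ = (a d̄ mod cr)`. [cite: BombieriFriedlanderIwaniecActa1986, §12 p. 236] -/
def dispE (a : ℤ) (C D H R : ℝ) (δ : ℕ → ℕ → ℂ) : ℝ :=
  ∑ c ∈ Finset.Icc 1 ⌊C⌋₊, ∑ d ∈ Finset.Icc 1 ⌊D⌋₊,
    ‖∑ h ∈ Finset.Icc 1 ⌊H⌋₊, ∑ r ∈ (Finset.Icc 1 ⌊R⌋₊).filter (fun r => d.Coprime (c * r)),
        δ h r * (𝐞 (((((a : ZMod (c * r)) * ((d : ZMod (c * r)))⁻¹).val : ℕ) : ℝ) * h /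
          ((c * r : ℕ) : ℝ)) : ℂ)‖ ^ 2

/-- `𝓔 ≥ 0`. [folklore] -/
theorem dispE_nonneg (a : ℤ) (C D H R : ℝ) (δ : ℕ → ℕ → ℂ) : 0 ≤ dispE a C D H R δ :=
  Finset.sum_nonneg fun _ _ => Finset.sum_nonneg fun _ _ => by positivity

/-- **Separation of variables** (BFI p. 236: "`α̂(h/qr) = q ∫ α(ξq) e(ξh/r) dξ`", in Mathlib's
normalisation of `𝓕`): `Φ_{qr}(h) = q ∫ e(−ξh/r) α(qξ) dξ` for `q ≥ 1`.
[cite: BombieriFriedlanderIwaniecActa1986, §12 p. 236] -/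
theorem fcoef_mul_eq_integral (M Y : ℝ) {q : ℕ} (hq : 0 < q) (r : ℕ) (h : ℤ) :
    fcoef M Y (q * r) h = (q : ℂ) * ∫ ξ : ℝ, (𝐞 (-(ξ * h / r)) : ℂ) * bumpC M Y (q * ξ) := by
  have hqr : (0 : ℝ) < q := by exact_mod_cast hq
  rw [fcoef_def, Real.fourier_real_eq]
  set g : ℝ → ℂ := fun v => 𝐞 (-(v * ((h : ℝ) / ((q * r : ℕ) : ℝ)))) • bumpC M Y v with hg
  have h1 : ∫ ξ : ℝ, g ((q : ℝ) * ξ) = |((q : ℝ))⁻¹| • ∫ v, g v := Measure.integral_comp_mul_left g _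
  rw [abs_of_pos (inv_pos.mpr hqr), ← Complex.coe_smul, Complex.ofReal_inv] at h1
  have h2 : ∫ v, g v = ((q : ℝ) : ℂ) * ∫ ξ : ℝ, g ((q : ℝ) * ξ) := by
    rw [h1, smul_eq_mul, ← mul_assoc, mul_inv_cancel₀ (by exact_mod_cast hqr.ne'), one_mul]
  rw [h2, Complex.ofReal_natCast]
  congr 1
  refine integral_congr_ae (Filter.Eventually.of_forall fun ξ => ?_)
  simp only [hg, Circle.smul_def, smul_eq_mul]
  rcases Nat.eq_zero_or_pos r with hr | hr
  · subst hr
    simp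
  · congr 3
    have hrr : (0 : ℝ) < r := by exact_mod_cast hr
    push_cast
    field_simp

/-- `twCoef(k, c, −h) = conj twCoef(k, c, h)` (the weight is real). [folklore] -/
theorem twCoef_neg (M Y : ℝ) (k : ℕ) (c : ZMod k) (h : ℤ) :
    twCoef M Y k c (-h) = (starRingEnd ℂ) (twCoef M Y k c h) := by
  rw [twCoef, twCoef, map_mul, fcoef_def, fcoef_def]
  congr 1
  · rw [← Circle.coe_inv_eq_conj, ← AddChar.map_neg_eq_inv]
    congr 1
    push_cast
    ring
  · have := FriedlanderIwaniecPrimes.fourier_neg_eq_conj (bump M Y) ((h : ℝ) / k)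
    rw [show (((-h : ℤ) : ℝ) / k) = -((h : ℝ) / k) by push_cast; ring]
    exact this

/-- The main term of `𝒟(α)` after Poisson summation: the sum over the moduli of the main terms of
`norm_bracketW_bump_sub_le`. [cite: BombieriFriedlanderIwaniecActa1986, §12 p. 236] -/
def mainTerm (a : ℤ) (M Y N Q R : ℝ) (β γ δ : ℕ → ℝ) (H₀ : ℕ) : ℂ :=
  ∑ q ∈ dyadic Q, ∑ r ∈ dyadic R,
    if IsCoprime ((q * r : ℕ) : ℤ) a then
      (γ q : ℂ) * (δ r : ℂ) * ((((q * r : ℕ) : ℂ))⁻¹ *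
        ∑ n ∈ (dyadic N).filter (fun n => n.Coprime (q * r)),
          (β n : ℂ) * oscSum M Y (q * r) ((a : ZMod (q * r)) * ((n : ZMod (q * r)))⁻¹) H₀)
    else 0

/-- The positive-frequency half of `mainTerm` (terms `1 ≤ h ≤ H₀`). [folklore] -/
def mainPlus (a : ℤ) (M Y N Q R : ℝ) (β γ δ : ℕ → ℝ) (H₀ : ℕ) : ℂ :=
  ∑ q ∈ dyadic Q, ∑ r ∈ dyadic R,
    if IsCoprime ((q * r : ℕ) : ℤ) a then
      (γ q : ℂ) * (δ r : ℂ) * ((((q * r : ℕ) : ℂ))⁻¹ *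
        ∑ n ∈ (dyadic N).filter (fun n => n.Coprime (q * r)),
          (β n : ℂ) * ∑ h ∈ Finset.Icc 1 H₀,
            twCoef M Y (q * r) ((a : ZMod (q * r)) * ((n : ZMod (q * r)))⁻¹) h)
    else 0

/-- `mainTerm = mainPlus + conj mainPlus` (pair `h` with `−h`). [folklore] -/
theorem mainTerm_eq (a : ℤ) (M Y N Q R : ℝ) (β γ δ : ℕ → ℝ) (H₀ : ℕ) :
    mainTerm a M Y N Q R β γ δ H₀ =
      mainPlus a M Y N Q R β γ δ H₀ + (starRingEnd ℂ) (mainPlus a M Y N Q R β γ δ H₀) := by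
  unfold mainTerm mainPlus
  rw [map_sum, ← Finset.sum_add_distrib]
  refine Finset.sum_congr rfl fun q _ => ?_
  rw [map_sum, ← Finset.sum_add_distrib]
  refine Finset.sum_congr rfl fun r _ => ?_
  split_ifs with hc
  · simp only [map_mul, map_inv₀, map_natCast, Complex.conj_ofReal, map_sum]
    rw [← mul_add, ← mul_add, ← Finset.sum_add_distrib]
    congr 2
    refine Finset.sum_congr rfl fun n _ => ?_
    rw [← mul_add, ← Finset.sum_add_distrib, oscSum]
    congr 1
    refine Finset.sum_congr rfl fun h _ => ?_
    rw [twCoef_neg]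
  · simp

/-- `‖mainTerm‖ ≤ 2 ‖mainPlus‖`. [folklore] -/
theorem norm_mainTerm_le (a : ℤ) (M Y N Q R : ℝ) (β γ δ : ℕ → ℝ) (H₀ : ℕ) :
    ‖mainTerm a M Y N Q R β γ δ H₀‖ ≤ 2 * ‖mainPlus a M Y N Q R β γ δ H₀‖ := by
  rw [mainTerm_eq]
  refine (norm_add_le _ _).trans ?_
  rw [Complex.norm_conj]
  linarith

/-- **`𝒟(α)` versus its main term**: summing `norm_bracketW_bump_sub_le` over the moduli with
the weights `|γ_q δ_r| ≤ τ(q)^B τ(r)^B`. [cite: BombieriFriedlanderIwaniecActa1986, §12 p. 236] -/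
theorem norm_dispDw_bump_sub_mainTerm_le {a : ℤ} {M Y : ℝ} (hY : 0 < Y) (hYM : Y ≤ M) (N : ℝ)
    {Q R B : ℝ} (hQ : 0 ≤ Q) (hR : 0 ≤ R) {β γ δ : ℕ → ℝ}
    (hγ : ∀ q, |γ q| ≤ (σ 0 q : ℝ) ^ B) (hδ : ∀ r, |δ r| ≤ (σ 0 r : ℝ) ^ B) (H₀ : ℕ) {j : ℕ}
    (hj : 2 ≤ j) (K : ℕ → ℕ) :
    ‖(dispDw a (mRange M Y) N Q R (fun m => bump M Y m) β γ δ : ℂ) -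
        mainTerm a M Y N Q R β γ δ H₀‖ ≤
      (∑ n ∈ dyadic N, |β n|) * ∑ q ∈ dyadic Q, ∑ r ∈ dyadic R,
        (σ 0 q : ℝ) ^ B * (σ 0 r : ℝ) ^ B *
          ((((q * r : ℕ) : ℝ))⁻¹ * tailBound Y j (q * r) H₀ +
            (∑ d ∈ (q * r).divisors, (d : ℝ)⁻¹ * (2 * K d * (M + 2 * Y) + tailBound Y j d (K d))) /
              (Nat.totient (q * r) : ℝ)) := by
  rw [dispDw_eq_sum_bracketW, mainTerm, Complex.ofReal_sum, Finset.mul_sum, ← Finset.sum_sub_distrib]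
  refine (norm_sum_le _ _).trans (Finset.sum_le_sum fun q hq => ?_)
  rw [Complex.ofReal_sum, Finset.mul_sum, ← Finset.sum_sub_distrib]
  refine (norm_sum_le _ _).trans (Finset.sum_le_sum fun r hr => ?_)
  have hq0 : 0 < q := pos_of_mem_dyadic hQ hq
  have hr0 : 0 < r := pos_of_mem_dyadic hR hr
  have hk : 0 < q * r := Nat.mul_pos hq0 hr0
  set Rk : ℝ := (((q * r : ℕ) : ℝ))⁻¹ * tailBound Y j (q * r) H₀ +
    (∑ d ∈ (q * r).divisors, (d : ℝ)⁻¹ * (2 * K d * (M + 2 * Y) + tailBound Y j d (K d))) /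
      (Nat.totient (q * r) : ℝ) with hRk
  have hβ0 : 0 ≤ ∑ n ∈ dyadic N, |β n| := Finset.sum_nonneg fun n _ => abs_nonneg _
  have hM : 0 ≤ M := hY.le.trans hYM
  have hRk0 : 0 ≤ Rk := by
    have h1 := tailBound_nonneg hY j (q * r) H₀
    have h2 : 0 ≤ ∑ d ∈ (q * r).divisors, (d : ℝ)⁻¹ * (2 * K d * (M + 2 * Y) + tailBound Y j d (K d)) :=
      Finset.sum_nonneg fun d _ => by have := tailBound_nonneg hY j d (K d); positivity
    positivity
  split_ifs with hcop
  · rw [Complex.ofReal_mul, Complex.ofReal_mul, ← mul_sub, norm_mul, norm_mul, Complex.norm_real,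
      Complex.norm_real, Real.norm_eq_abs, Real.norm_eq_abs]
    have hb := norm_bracketW_bump_sub_le hY hYM N hk hcop β H₀ hj K
    rw [← hRk] at hb
    refine le_trans (mul_le_mul (mul_le_mul (hγ q) (hδ r) (abs_nonneg _) (by positivity)) hb
      (norm_nonneg _) (by positivity)) (le_of_eq ?_)
    ring
  · rw [Complex.ofReal_zero, sub_self, norm_zero]
    positivity


/-! ### The main term as an integral, and its bound through `𝓔` -/

/-- The coefficients `δ_ξ(h, r) = (R/T)(δ_r/r) e(−ξh/r) · 1[r ∼ R, (r, a) = 1]` fed into `𝓔`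
(BFI p. 236: "with some real `ξ`"; here for every `ξ`). [cite: BombieriFriedlanderIwaniecActa1986, §12 p. 236] -/
def deltaXi (a : ℤ) (R T : ℝ) (δ : ℕ → ℝ) (ξ : ℝ) (h r : ℕ) : ℂ :=
  if r ∈ dyadic R ∧ IsCoprime (r : ℤ) a then
    ((R / T * (δ r / r) : ℝ) : ℂ) * (𝐞 (-(ξ * h / r)) : ℂ) else 0

/-- `|δ_ξ(h, r)| ≤ 1` as soon as `|δ_r| R/r ≤ T` on `r ∼ R` (`T > 0`). [folklore] -/
theorem norm_deltaXi_le_one {a : ℤ} {R T : ℝ} (hR : 0 ≤ R) (hT : 0 < T) {δ : ℕ → ℝ}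
    (hδT : ∀ r ∈ dyadic R, |δ r| * R / r ≤ T) (ξ : ℝ) (h r : ℕ) :
    ‖deltaXi a R T δ ξ h r‖ ≤ 1 := by
  unfold deltaXi
  split_ifs with hr
  · rw [norm_mul, Circle.norm_coe, mul_one, Complex.norm_real, Real.norm_eq_abs]
    have hr0 : (0 : ℝ) < r := by exact_mod_cast pos_of_mem_dyadic hR hr.1
    have h1 := hδT r hr.1
    rw [show R / T * (δ r / r) = (δ r * R / r) / T by field_simp]
    rw [abs_div, abs_of_pos hT, div_le_one hT]
    refine le_trans (le_of_eq ?_) h1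
    rw [abs_div, abs_mul, abs_of_nonneg hR, abs_of_pos hr0]
  · rw [norm_zero]; exact zero_le_one

/-- The inner double sum of `𝓔` at `(c, d)`. [cite: BombieriFriedlanderIwaniecActa1986, §12 p. 236] -/
def innerE (a : ℤ) (H R : ℝ) (δ' : ℕ → ℕ → ℂ) (c d : ℕ) : ℂ :=
  ∑ h ∈ Finset.Icc 1 ⌊H⌋₊, ∑ r ∈ (Finset.Icc 1 ⌊R⌋₊).filter (fun r => d.Coprime (c * r)),
    δ' h r * (𝐞 (((((a : ZMod (c * r)) * ((d : ZMod (c * r)))⁻¹).val : ℕ) : ℝ) * h /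
      ((c * r : ℕ) : ℝ)) : ℂ)

/-- `𝓔 = ∑_c ∑_d ‖innerE(c, d)‖²`. [folklore] -/
theorem dispE_eq (a : ℤ) (C D H R : ℝ) (δ' : ℕ → ℕ → ℂ) :
    dispE a C D H R δ' = ∑ c ∈ Finset.Icc 1 ⌊C⌋₊, ∑ d ∈ Finset.Icc 1 ⌊D⌋₊, ‖innerE a H R δ' c d‖ ^ 2 :=
  rfl

/-- The kernel `G(q, n, ξ)` multiplying `α(qξ)` in the integral form of the main term:
`∑_{r∼R, (qr,a)=1, (n,qr)=1} ∑_{1≤h≤H₀} (δ_r/r) e(h·(a n̄ mod qr)/(qr)) e(−ξh/r)`.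
[cite: BombieriFriedlanderIwaniecActa1986, §12 p. 236] -/
def Gsum (a : ℤ) (R : ℝ) (δ : ℕ → ℝ) (H₀ : ℕ) (ξ : ℝ) (q n : ℕ) : ℂ :=
  ∑ r ∈ dyadic R, ∑ h ∈ Finset.Icc 1 H₀,
    if IsCoprime ((q * r : ℕ) : ℤ) a ∧ n.Coprime (q * r) then
      ((δ r / r : ℝ) : ℂ) *
        (𝐞 (((((a : ZMod (q * r)) * ((n : ZMod (q * r)))⁻¹).val : ℕ) : ℝ) * h /
          ((q * r : ℕ) : ℝ)) : ℂ) * (𝐞 (-(ξ * h / r)) : ℂ)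
    else 0

/-- `ξ ↦ e(f(ξ))` is continuous for continuous `f`. [folklore] -/
theorem continuous_e_comp {f : ℝ → ℝ} (hf : Continuous f) :
    Continuous fun ξ => ((𝐞 (f ξ) : Circle) : ℂ) :=
  continuous_subtype_val.comp (Real.continuous_fourierChar.comp hf)

/-- `ξ ↦ G(q, n, ξ)` is continuous. [folklore] -/
theorem continuous_Gsum (a : ℤ) (R : ℝ) (δ : ℕ → ℝ) (H₀ : ℕ) (q n : ℕ) :
    Continuous fun ξ => Gsum a R δ H₀ ξ q n := by
  unfold Gsum
  refine continuous_finsetSum _ fun r _ => continuous_finsetSum _ fun h _ => ?_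
  split_ifs
  · exact (continuous_const.mul (continuous_e_comp (by fun_prop)))
  · exact continuous_const

/-- `ξ ↦ α_ℂ(qξ)` is continuous with compact support (`q ≥ 1`). [folklore] -/
theorem continuous_hasCompactSupport_bumpC_comp {M Y : ℝ} (hY : 0 < Y) (hM : 0 ≤ M) {q : ℕ}
    (hq : 0 < q) :
    Continuous (fun ξ : ℝ => bumpC M Y (q * ξ)) ∧ HasCompactSupport (fun ξ : ℝ => bumpC M Y (q * ξ)) := by
  have hqr : (q : ℝ) ≠ 0 := by exact_mod_cast hq.ne'
  refine ⟨(contDiff_bumpC M Y).continuous.comp (continuous_const.mul continuous_id), ?_⟩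
  have h := (hasCompactSupport_bumpC hY hM).comp_homeomorph (Homeomorph.mulLeft₀ (q : ℝ) hqr)
  exact h

/-- **The positive-frequency main term as an integral against `α(qξ)`** (BFI p. 236, the display
"giving `𝒟 ≪ … + x^{2ε} R H⁻¹ ∑_q ∑_n |β_n| |∑_h ∑_r (δ_r/r) e(ξh/r) e(−ahn̄/qr)|`", before taking
absolute values): for `q ≥ 1`,
`∑_{r} [(qr,a)=1] γ_q δ_r (qr)⁻¹ ∑_{(n,qr)=1} β_n ∑_{h≤H₀} twCoef(qr, a n̄, h)
   = ∑_n γ_q β_n ∫ α(qξ) G(q, n, ξ) dξ`. [cite: BombieriFriedlanderIwaniecActa1986, §12 p. 236] -/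
theorem mainPlus_row_eq {a : ℤ} {M Y : ℝ} (hY : 0 < Y) (hYM : Y ≤ M) (N : ℝ) {R : ℝ} (hR : 0 ≤ R)
    (β γ δ : ℕ → ℝ) (H₀ : ℕ) {q : ℕ} (hq : 0 < q) :
    ∑ r ∈ dyadic R,
        (if IsCoprime ((q * r : ℕ) : ℤ) a then
          (γ q : ℂ) * (δ r : ℂ) * ((((q * r : ℕ) : ℂ))⁻¹ *
            ∑ n ∈ (dyadic N).filter (fun n => n.Coprime (q * r)),
              (β n : ℂ) * ∑ h ∈ Finset.Icc 1 H₀,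
                twCoef M Y (q * r) ((a : ZMod (q * r)) * ((n : ZMod (q * r)))⁻¹) h)
        else 0) =
      ∑ n ∈ dyadic N, (γ q : ℂ) * (β n : ℂ) * ∫ ξ : ℝ, bumpC M Y (q * ξ) * Gsum a R δ H₀ ξ q n := by
  have hM : 0 ≤ M := hY.le.trans hYM
  have hq0 : (q : ℂ) ≠ 0 := by exact_mod_cast hq.ne'
  obtain ⟨hcont, hsupp⟩ := continuous_hasCompactSupport_bumpC_comp hY hM hq
  -- the summand as a function of `(r, n, h, ξ)`
  set X : ℕ → ℕ → ℕ → ℝ → ℂ := fun r n h ξ =>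
    if IsCoprime ((q * r : ℕ) : ℤ) a ∧ n.Coprime (q * r) then
      ((δ r / r : ℝ) : ℂ) *
        (𝐞 (((((a : ZMod (q * r)) * ((n : ZMod (q * r)))⁻¹).val : ℕ) : ℝ) * h /
          ((q * r : ℕ) : ℝ)) : ℂ) * (𝐞 (-(ξ * h / r)) : ℂ)
    else 0 with hX
  have hXcont : ∀ r n h, Continuous (X r n h) := by
    intro r n h
    simp only [hX]
    split_ifs
    · exact continuous_const.mul (continuous_e_comp (by fun_prop))
    · exact continuous_const
  have hint : ∀ r n h, Integrable (fun ξ : ℝ => bumpC M Y (q * ξ) * X r n h ξ) := fun r n h =>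
    (hcont.mul (hXcont r n h)).integrable_of_hasCompactSupport hsupp.mul_right
  -- Step 1: the scalar identity for each `(r, n, h)`
  have hscal : ∀ r ∈ dyadic R, ∀ n h : ℕ, IsCoprime ((q * r : ℕ) : ℤ) a → n.Coprime (q * r) →
      (γ q : ℂ) * (δ r : ℂ) * ((((q * r : ℕ) : ℂ))⁻¹ * ((β n : ℂ) *
        twCoef M Y (q * r) ((a : ZMod (q * r)) * ((n : ZMod (q * r)))⁻¹) h)) =
        (γ q : ℂ) * (β n : ℂ) * ∫ ξ : ℝ, bumpC M Y (q * ξ) * X r n h ξ := by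
    intro r hr n h hcop hn
    have hr0 : 0 < r := pos_of_mem_dyadic hR hr
    have hr0' : (r : ℂ) ≠ 0 := by exact_mod_cast hr0.ne'
    rw [twCoef, fcoef_mul_eq_integral M Y hq r h]
    set E₁ : ℂ := (𝐞 (((((a : ZMod (q * r)) * ((n : ZMod (q * r)))⁻¹).val : ℕ) : ℝ) * (h : ℤ) /
      ((q * r : ℕ) : ℝ)) : ℂ) with hE₁
    set Cst : ℂ := (γ q : ℂ) * (δ r : ℂ) * (((q * r : ℕ) : ℂ))⁻¹ * (β n : ℂ) * E₁ * (q : ℂ)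
      with hCst
    have key : Cst * ∫ ξ : ℝ, (𝐞 (-(ξ * (h : ℤ) / r)) : ℂ) * bumpC M Y (q * ξ) =
        (γ q : ℂ) * (β n : ℂ) * ∫ ξ : ℝ, bumpC M Y (q * ξ) * X r n h ξ := by
      rw [← integral_const_mul Cst, ← integral_const_mul ((γ q : ℂ) * (β n : ℂ))]
      refine integral_congr_ae (Filter.Eventually.of_forall fun ξ => ?_)
      simp only [hX, if_pos (And.intro hcop hn), hCst, hE₁]
      push_cast
      field_simp
    rw [← key, hCst]
    ring
  -- Step 2: rearrange the finite sums
  calc ∑ r ∈ dyadic R,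
        (if IsCoprime ((q * r : ℕ) : ℤ) a then
          (γ q : ℂ) * (δ r : ℂ) * ((((q * r : ℕ) : ℂ))⁻¹ *
            ∑ n ∈ (dyadic N).filter (fun n => n.Coprime (q * r)),
              (β n : ℂ) * ∑ h ∈ Finset.Icc 1 H₀,
                twCoef M Y (q * r) ((a : ZMod (q * r)) * ((n : ZMod (q * r)))⁻¹) h)
        else 0)
      = ∑ r ∈ dyadic R, ∑ n ∈ dyadic N, ∑ h ∈ Finset.Icc 1 H₀,
          (γ q : ℂ) * (β n : ℂ) * ∫ ξ : ℝ, bumpC M Y (q * ξ) * X r n h ξ := by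
        refine Finset.sum_congr rfl fun r hr => ?_
        by_cases hcop : IsCoprime ((q * r : ℕ) : ℤ) a
        · rw [if_pos hcop, Finset.mul_sum, Finset.mul_sum, Finset.sum_filter]
          refine Finset.sum_congr rfl fun n _ => ?_
          by_cases hn : n.Coprime (q * r)
          · rw [if_pos hn, Finset.mul_sum, Finset.mul_sum, Finset.mul_sum]
            exact Finset.sum_congr rfl fun h _ => hscal r hr n h hcop hn
          · rw [if_neg hn]
            symm
            refine Finset.sum_eq_zero fun h _ => ?_
            simp only [hX, hn, and_false, if_false, mul_zero, integral_zero]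
        · rw [if_neg hcop]
          symm
          refine Finset.sum_eq_zero fun n _ => Finset.sum_eq_zero fun h _ => ?_
          simp only [hX, hcop, false_and, if_false, mul_zero, integral_zero]
    _ = ∑ n ∈ dyadic N, ∑ r ∈ dyadic R, ∑ h ∈ Finset.Icc 1 H₀,
          (γ q : ℂ) * (β n : ℂ) * ∫ ξ : ℝ, bumpC M Y (q * ξ) * X r n h ξ := Finset.sum_comm
    _ = ∑ n ∈ dyadic N, (γ q : ℂ) * (β n : ℂ) *
          ∫ ξ : ℝ, bumpC M Y (q * ξ) * Gsum a R δ H₀ ξ q n := by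
        refine Finset.sum_congr rfl fun n _ => ?_
        simp_rw [← Finset.mul_sum]
        congr 1
        have e1 : ∫ ξ : ℝ, bumpC M Y (q * ξ) * Gsum a R δ H₀ ξ q n =
            ∫ ξ : ℝ, ∑ r ∈ dyadic R, ∑ h ∈ Finset.Icc 1 H₀, bumpC M Y (q * ξ) * X r n h ξ := by
          refine integral_congr_ae (Filter.Eventually.of_forall fun ξ => ?_)
          simp only [Gsum, hX, Finset.mul_sum]
        rw [e1, integral_finsetSum _ fun r _ => integrable_finsetSum _ fun h _ => hint r n h]
        refine Finset.sum_congr rfl fun r _ => ?_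
        rw [integral_finsetSum _ fun h _ => hint r n h]


/-- **`G` is `(T/R)` times the inner sum of `𝓔` with the coefficients `δ_ξ`** (for `q ∼ Q` coprime
to `a`; otherwise `G = 0`). [cite: BombieriFriedlanderIwaniecActa1986, §12 p. 236] -/
theorem Gsum_eq {a : ℤ} {R T : ℝ} (hR : 0 < R) (hT : 0 < T) (δ : ℕ → ℝ) (H₀ : ℕ) (ξ : ℝ)
    (q n : ℕ) :
    Gsum a R δ H₀ ξ q n =
      if IsCoprime (q : ℤ) a then
        ((T / R : ℝ) : ℂ) * innerE a (H₀ : ℝ) (2 * R) (deltaXi a R T δ ξ) q n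
      else 0 := by
  unfold Gsum innerE
  rw [Nat.floor_natCast]
  split_ifs with hqa
  · conv_rhs => rw [Finset.sum_comm]
    rw [Finset.mul_sum]
    -- reduce the range of `r` to `r ∼ R`
    have hsub : (dyadic R).filter (fun r => n.Coprime (q * r)) ⊆
        (Finset.Icc 1 ⌊2 * R⌋₊).filter (fun r => n.Coprime (q * r)) :=
      Finset.filter_subset_filter _ (dyadic_subset_Icc hR.le)
    symm
    rw [← Finset.sum_subset hsub]
    · rw [Finset.sum_filter]
      refine Finset.sum_congr rfl fun r hr => ?_
      have hr0 : (0 : ℝ) < r := by exact_mod_cast pos_of_mem_dyadic hR.le hr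
      by_cases hn : n.Coprime (q * r)
      · rw [if_pos hn, Finset.mul_sum]
        refine Finset.sum_congr rfl fun h _ => ?_
        have hiff : IsCoprime ((q * r : ℕ) : ℤ) a ↔ IsCoprime (r : ℤ) a := by
          rw [Nat.cast_mul, IsCoprime.mul_left_iff]
          exact ⟨fun h => h.2, fun h => ⟨hqa, h⟩⟩
        unfold deltaXi
        by_cases hra : IsCoprime (r : ℤ) a
        · rw [if_pos ⟨hr, hra⟩, if_pos ⟨hiff.2 hra, hn⟩]
          have hT' : (T : ℂ) ≠ 0 := by exact_mod_cast hT.ne'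
          have hR' : (R : ℂ) ≠ 0 := by exact_mod_cast hR.ne'
          have hr' : (r : ℂ) ≠ 0 := by exact_mod_cast hr0.ne'
          have hTR : ((T / R : ℝ) : ℂ) * ((R / T * (δ r / r) : ℝ) : ℂ) = ((δ r / r : ℝ) : ℂ) := by
            push_cast
            field_simp
          rw [← mul_assoc, ← mul_assoc, hTR]
          ring
        · rw [if_neg (fun h => hra h.2), if_neg (fun h => hra (hiff.1 h.1)), zero_mul, mul_zero]
      · rw [if_neg hn]
        exact (Finset.sum_eq_zero fun h _ => by rw [if_neg (fun h => hn h.2)]).symm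
    · intro r hr hr'
      have hr'' : r ∉ dyadic R := by
        intro h
        exact hr' (Finset.mem_filter.2 ⟨h, (Finset.mem_filter.1 hr).2⟩)
      refine mul_eq_zero_of_right _ (Finset.sum_eq_zero fun h _ => ?_)
      unfold deltaXi
      rw [if_neg (fun h => hr'' h.1), zero_mul]
  · refine Finset.sum_eq_zero fun r _ => Finset.sum_eq_zero fun h _ => ?_
    rw [if_neg]
    intro h
    rw [Nat.cast_mul, IsCoprime.mul_left_iff] at h
    exact hqa h.1.1

/-- **`∑_{q∼Q} ∑_{n∼N} |G(q,n,ξ)|² ≤ (T/R)² 𝓔(2Q, 2N, H₀, 2R; δ_ξ)`** (drop the condition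
`(q, a) = 1` and enlarge the ranges of `q`, `n`). [cite: BombieriFriedlanderIwaniecActa1986, §12 (12.2) p. 236] -/
theorem sum_norm_sq_Gsum_le {a : ℤ} {N Q R T : ℝ} (hN : 0 ≤ N) (hQ : 0 ≤ Q) (hR : 0 < R)
    (hT : 0 < T) (δ : ℕ → ℝ) (H₀ : ℕ) (ξ : ℝ) :
    ∑ q ∈ dyadic Q, ∑ n ∈ dyadic N, ‖Gsum a R δ H₀ ξ q n‖ ^ 2 ≤
      (T / R) ^ 2 * dispE a (2 * Q) (2 * N) H₀ (2 * R) (deltaXi a R T δ ξ) := by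
  rw [dispE_eq, Finset.mul_sum]
  calc ∑ q ∈ dyadic Q, ∑ n ∈ dyadic N, ‖Gsum a R δ H₀ ξ q n‖ ^ 2
      ≤ ∑ q ∈ dyadic Q, ∑ n ∈ dyadic N,
          (T / R) ^ 2 * ‖innerE a (H₀ : ℝ) (2 * R) (deltaXi a R T δ ξ) q n‖ ^ 2 := by
        refine Finset.sum_le_sum fun q _ => Finset.sum_le_sum fun n _ => ?_
        rw [Gsum_eq hR hT]
        split_ifs
        · rw [norm_mul, mul_pow, Complex.norm_real, Real.norm_of_nonneg (div_pos hT hR).le]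
        · rw [norm_zero, zero_pow two_ne_zero]
          positivity
    _ ≤ ∑ q ∈ Finset.Icc 1 ⌊2 * Q⌋₊, ∑ n ∈ dyadic N,
          (T / R) ^ 2 * ‖innerE a (H₀ : ℝ) (2 * R) (deltaXi a R T δ ξ) q n‖ ^ 2 :=
        Finset.sum_le_sum_of_subset_of_nonneg (dyadic_subset_Icc hQ) fun q _ _ =>
          Finset.sum_nonneg fun n _ => by positivity
    _ ≤ ∑ q ∈ Finset.Icc 1 ⌊2 * Q⌋₊, ∑ n ∈ Finset.Icc 1 ⌊2 * N⌋₊,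
          (T / R) ^ 2 * ‖innerE a (H₀ : ℝ) (2 * R) (deltaXi a R T δ ξ) q n‖ ^ 2 :=
        Finset.sum_le_sum fun q _ =>
          Finset.sum_le_sum_of_subset_of_nonneg (dyadic_subset_Icc hN) fun n _ _ => by positivity
    _ = _ := by
        refine Finset.sum_congr rfl fun q _ => ?_
        rw [Finset.mul_sum]

/-- For `q ∼ Q` (`Q > 0`, `0 ≤ M − Y`), `α(qξ) = 0` unless
`ξ ∈ I = [(M − Y)/(2Q), (2M + Y)/Q]`. [folklore] -/
theorem bumpC_mul_eq_zero {M Y Q : ℝ} (hY : 0 < Y) (hYM : Y ≤ M) (hQ : 0 < Q) {q : ℕ}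
    (hq : q ∈ dyadic Q) {ξ : ℝ} (hξ : ξ ∉ Set.Icc ((M - Y) / (2 * Q)) ((2 * M + Y) / Q)) :
    bumpC M Y (q * ξ) = 0 := by
  have hM : 0 ≤ M := hY.le.trans hYM
  obtain ⟨hq1, hq2⟩ := (mem_dyadic hQ.le).1 hq
  rw [Set.mem_Icc, not_and_or, not_le, not_le] at hξ
  refine bumpC_eq_zero hY hM ?_
  rcases hξ with hξ | hξ
  · left
    rcases le_or_gt ξ 0 with h0 | h0
    · have : (q : ℝ) * ξ ≤ 0 := mul_nonpos_of_nonneg_of_nonpos (by positivity) h0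
      linarith
    · have h1 : (q : ℝ) * ξ ≤ 2 * Q * ξ := mul_le_mul_of_nonneg_right hq2 h0.le
      have h2 : 2 * Q * ξ < 2 * Q * ((M - Y) / (2 * Q)) := mul_lt_mul_of_pos_left hξ (by linarith)
      rw [mul_div_cancel₀ _ (by linarith : (2 * Q) ≠ 0)] at h2
      linarith
  · right
    have h0 : 0 < ξ := lt_trans (by positivity) hξ
    have h1 : Q * ξ < (q : ℝ) * ξ := mul_lt_mul_of_pos_right hq1 h0
    have h2 : Q * ((2 * M + Y) / Q) < Q * ξ := mul_lt_mul_of_pos_left hξ hQ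
    rw [mul_div_cancel₀ _ hQ.ne'] at h2
    linarith

/-- **The bound for the main term** (BFI (12.2), p. 236: "Hence by Cauchy's inequality
`𝒟 ≪ … + ‖β‖ x^ε M Q^{−1/2} R⁻¹ 𝓔^{1/2}(2Q, 2N, H, 2R)`", here with all constants explicit):
if `|δ_r| R/r ≤ T` on `r ∼ R` and `𝓔(2Q, 2N, H₀, 2R; δ_ξ) ≤ E` for every `ξ`, then
`‖mainPlus‖ ≤ (3M/Q) · (∑_{q∼Q} γ_q² · ‖β‖²)^{1/2} · (T/R) · E^{1/2}`.
[cite: BombieriFriedlanderIwaniecActa1986, §12 (12.2) p. 236] -/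
theorem norm_mainPlus_le {a : ℤ} {M Y N Q R : ℝ} (hY : 0 < Y) (hYM : Y ≤ M) (hN : 0 ≤ N)
    (hQ : 0 < Q) (hR : 0 < R) (β γ δ : ℕ → ℝ) (H₀ : ℕ) {T E : ℝ} (hT : 0 < T)
    (hE : ∀ ξ : ℝ, dispE a (2 * Q) (2 * N) H₀ (2 * R) (deltaXi a R T δ ξ) ≤ E) :
    ‖mainPlus a M Y N Q R β γ δ H₀‖ ≤
      3 * M / Q * Real.sqrt ((∑ q ∈ dyadic Q, γ q ^ 2) * l2Sq N β) * (T / R) * Real.sqrt E := by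
  have hM : 0 ≤ M := hY.le.trans hYM
  set I : Set ℝ := Set.Icc ((M - Y) / (2 * Q)) ((2 * M + Y) / Q) with hI
  set Γ₂ : ℝ := ∑ q ∈ dyadic Q, γ q ^ 2 with hΓ₂
  set Cst : ℝ := Real.sqrt (Γ₂ * l2Sq N β) * (T / R) * Real.sqrt E with hCst
  have hCst0 : 0 ≤ Cst := by positivity
  have hE0 : 0 ≤ E := le_trans (dispE_nonneg _ _ _ _ _ _) (hE 0)
  -- the integrand after taking absolute values
  set F : ℝ → ℝ := fun ξ => ∑ q ∈ dyadic Q, ∑ n ∈ dyadic N, |γ q| * |β n| * ‖Gsum a R δ H₀ ξ q n‖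
    with hF
  -- Step 1: pointwise Cauchy–Schwarz: `F ξ ≤ Cst`
  have hFle : ∀ ξ, F ξ ≤ Cst := by
    intro ξ
    have hCS := Finset.sum_mul_sq_le_sq_mul_sq (dyadic Q ×ˢ dyadic N)
      (fun p => |γ p.1| * |β p.2|) (fun p => ‖Gsum a R δ H₀ ξ p.1 p.2‖)
    have e1 : ∑ p ∈ dyadic Q ×ˢ dyadic N, |γ p.1| * |β p.2| * ‖Gsum a R δ H₀ ξ p.1 p.2‖ = F ξ := by
      rw [hF, Finset.sum_product]
    have e2 : ∑ p ∈ dyadic Q ×ˢ dyadic N, (|γ p.1| * |β p.2|) ^ 2 = Γ₂ * l2Sq N β := by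
      rw [Finset.sum_product, hΓ₂, l2Sq, Finset.sum_mul_sum]
      refine Finset.sum_congr rfl fun q _ => Finset.sum_congr rfl fun n _ => ?_
      rw [mul_pow, sq_abs, sq_abs]
    have e3 : ∑ p ∈ dyadic Q ×ˢ dyadic N, ‖Gsum a R δ H₀ ξ p.1 p.2‖ ^ 2 ≤ (T / R) ^ 2 * E := by
      rw [Finset.sum_product]
      exact (sum_norm_sq_Gsum_le hN hQ.le hR hT δ H₀ ξ).trans
        (mul_le_mul_of_nonneg_left (hE ξ) (by positivity))
    rw [e1, e2] at hCS
    have hF0 : 0 ≤ F ξ := Finset.sum_nonneg fun q _ => Finset.sum_nonneg fun n _ => by positivity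
    have h4 : F ξ ^ 2 ≤ (Γ₂ * l2Sq N β) * ((T / R) ^ 2 * E) :=
      hCS.trans (mul_le_mul_of_nonneg_left e3 (by rw [hΓ₂]; have := l2Sq_nonneg N β; positivity))
    calc F ξ = Real.sqrt (F ξ ^ 2) := (Real.sqrt_sq hF0).symm
      _ ≤ Real.sqrt ((Γ₂ * l2Sq N β) * ((T / R) ^ 2 * E)) := Real.sqrt_le_sqrt h4
      _ = Cst := by
          rw [hCst, Real.sqrt_mul (by rw [hΓ₂]; have := l2Sq_nonneg N β; positivity),
            Real.sqrt_mul (sq_nonneg (T / R)) E, Real.sqrt_sq (div_pos hT hR).le]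
          ring
  -- Step 2: each integral is bounded by `∫_I ‖G‖`
  have hrow : ∀ q ∈ dyadic Q, ∀ n : ℕ,
      ‖∫ ξ : ℝ, bumpC M Y (q * ξ) * Gsum a R δ H₀ ξ q n‖ ≤ ∫ ξ in I, ‖Gsum a R δ H₀ ξ q n‖ := by
    intro q hq n
    have hq0 : 0 < q := pos_of_mem_dyadic hQ.le hq
    obtain ⟨hcont, hsupp⟩ := continuous_hasCompactSupport_bumpC_comp hY hM hq0
    have hGc := continuous_Gsum a R δ H₀ q n
    have hint : Integrable (fun ξ : ℝ => bumpC M Y (q * ξ) * Gsum a R δ H₀ ξ q n) :=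
      (hcont.mul hGc).integrable_of_hasCompactSupport hsupp.mul_right
    refine (norm_integral_le_integral_norm _).trans ?_
    rw [← integral_indicator measurableSet_Icc]
    refine integral_mono hint.norm ?_ fun ξ => ?_
    · rw [integrable_indicator_iff measurableSet_Icc]
      exact (hGc.norm.continuousOn).integrableOn_Icc
    · by_cases hξ : ξ ∈ I
      · rw [Set.indicator_of_mem hξ, norm_mul]
        exact mul_le_of_le_one_left (norm_nonneg _) (norm_bumpC_le_one hY hM _)
      · rw [Set.indicator_of_notMem hξ, bumpC_mul_eq_zero hY hYM hQ hq hξ, zero_mul, norm_zero]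
  -- Step 3: assemble
  have hvol : volume I < ⊤ := by rw [hI, Real.volume_Icc]; exact ENNReal.ofReal_lt_top
  have hIreal : volume.real I ≤ 3 * M / Q := by
    have e : (2 * M + Y) / Q - (M - Y) / (2 * Q) = (3 * M + 3 * Y) / (2 * Q) := by
      field_simp
      ring
    rw [Measure.real, hI, Real.volume_Icc, e, ENNReal.toReal_ofReal (by positivity),
      div_le_div_iff₀ (by positivity) hQ]
    nlinarith [mul_le_mul_of_nonneg_right hYM hQ.le]
  calc ‖mainPlus a M Y N Q R β γ δ H₀‖
      = ‖∑ q ∈ dyadic Q, ∑ n ∈ dyadic N, (γ q : ℂ) * (β n : ℂ) *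
          ∫ ξ : ℝ, bumpC M Y (q * ξ) * Gsum a R δ H₀ ξ q n‖ := by
        rw [mainPlus]
        congr 1
        exact Finset.sum_congr rfl fun q hq =>
          mainPlus_row_eq hY hYM N hR.le β γ δ H₀ (pos_of_mem_dyadic hQ.le hq)
    _ ≤ ∑ q ∈ dyadic Q, ∑ n ∈ dyadic N, |γ q| * |β n| * ∫ ξ in I, ‖Gsum a R δ H₀ ξ q n‖ := by
        refine (norm_sum_le _ _).trans (Finset.sum_le_sum fun q hq => ?_)
        refine (norm_sum_le _ _).trans (Finset.sum_le_sum fun n _ => ?_)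
        rw [norm_mul, norm_mul, Complex.norm_real, Complex.norm_real, Real.norm_eq_abs,
          Real.norm_eq_abs]
        exact mul_le_mul_of_nonneg_left (hrow q hq n) (by positivity)
    _ = ∫ ξ in I, F ξ := by
        rw [hF, integral_finsetSum _ fun q _ => ?_]
        · refine Finset.sum_congr rfl fun q _ => ?_
          rw [integral_finsetSum _ fun n _ => ?_]
          · refine Finset.sum_congr rfl fun n _ => ?_
            rw [integral_const_mul]
          · exact ((continuous_Gsum a R δ H₀ q n).norm.continuousOn.integrableOn_Icc).const_mul _
        · refine integrable_finsetSum _ fun n _ => ?_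
          exact ((continuous_Gsum a R δ H₀ q n).norm.continuousOn.integrableOn_Icc).const_mul _
    _ ≤ Cst * volume.real I := by
        have hb := norm_setIntegral_le_of_norm_le_const hvol (f := F) (C := Cst)
          (fun ξ _ => by
            rw [Real.norm_of_nonneg (Finset.sum_nonneg fun q _ =>
              Finset.sum_nonneg fun n _ => by positivity)]
            exact hFle ξ)
        exact le_trans (Real.le_norm_self _) hb
    _ ≤ Cst * (3 * M / Q) := mul_le_mul_of_nonneg_left hIreal hCst0
    _ = _ := by rw [hCst]; ring


/-- **The structural form of BFI (12.2)** (p. 236): for `0 < Y ≤ M`, `|a| ≤ M − Y`, `Q, R > 0`,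
`N ≥ 0`, divisor-type weights `γ, δ`, every truncation `H₀`, decay order `j ≥ 2`, split points
`K(d)`, a bound `D₀` for `τ(mn − a)` on the transition ranges, `T ≥ |δ_r| R/r` on `r ∼ R`, and a
bound `E` for `𝓔(2Q, 2N, H₀, 2R; δ')` uniform over `|δ'| ≤ 1`:
`|𝒟(M,N,Q,R; 1, β, γ, δ)| ≤ (smoothing error (12.1)) + (Poisson tails and the coprimality error)
   + 2 · (3M/Q) (∑_{q∼Q} γ_q² ‖β‖²)^{1/2} (T/R) E^{1/2}`.
The three lines are `abs_dispD_sub_dispDw_bump_le`, `norm_dispDw_bump_sub_mainTerm_le` and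
`norm_mainPlus_le`; the choice `Y = Mx^{−ε₁}`, `H₀ = ⌊x^{2ε₁}QR/M⌋`, `j ≍ 1/ε₁`, … turning this
into (12.2) `𝒟 ≪ ‖β‖ M^{1/2} x^{1/2−ε/2} + ‖β‖ x^ε M Q^{−1/2} R⁻¹ 𝓔^{1/2}` is left to the assembly.
[cite: BombieriFriedlanderIwaniecActa1986, §12 (12.2) p. 236] -/
theorem abs_dispD_one_le_structural {a : ℤ} {M Y N Q R B D₀ T E : ℝ} (hY : 0 < Y) (hYM : Y ≤ M)
    (ha : (|a| : ℝ) ≤ M - Y) (hN : 0 ≤ N) (hQ : 0 < Q) (hR : 0 < R) (hB : 0 ≤ B) (hD₀ : 1 ≤ D₀)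
    (hD : ∀ m ∈ bumpDiffSupport M Y, ∀ n ∈ dyadic N,
      (σ 0 ((((m * n : ℕ) : ℤ) - a).toNat) : ℝ) ≤ D₀)
    {β γ δ : ℕ → ℝ} (hγ : ∀ q, |γ q| ≤ (σ 0 q : ℝ) ^ B) (hδ : ∀ r, |δ r| ≤ (σ 0 r : ℝ) ^ B)
    (H₀ : ℕ) {j : ℕ} (hj : 2 ≤ j) (K : ℕ → ℕ) (hT : 0 < T)
    (hδT : ∀ r ∈ dyadic R, |δ r| * R / r ≤ T)
    (hE : ∀ δ' : ℕ → ℕ → ℂ, (∀ h r, ‖δ' h r‖ ≤ 1) → dispE a (2 * Q) (2 * N) H₀ (2 * R) δ' ≤ E) :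
    |dispD a M N Q R (fun _ => 1) β γ δ| ≤
      (2 * Y + 2) * (∑ n ∈ dyadic N, |β n|) *
          (D₀ ^ (2 * B + 2) +
            (∑ q ∈ dyadic Q, (σ 0 q : ℝ) ^ (B + 1) / q) *
              (∑ r ∈ dyadic R, (σ 0 r : ℝ) ^ (B + 1) / r)) +
        (∑ n ∈ dyadic N, |β n|) * (∑ q ∈ dyadic Q, ∑ r ∈ dyadic R,
          (σ 0 q : ℝ) ^ B * (σ 0 r : ℝ) ^ B *
            ((((q * r : ℕ) : ℝ))⁻¹ * tailBound Y j (q * r) H₀ +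
              (∑ d ∈ (q * r).divisors, (d : ℝ)⁻¹ * (2 * K d * (M + 2 * Y) + tailBound Y j d (K d))) /
                (Nat.totient (q * r) : ℝ))) +
        2 * (3 * M / Q * Real.sqrt ((∑ q ∈ dyadic Q, γ q ^ 2) * l2Sq N β) * (T / R) *
          Real.sqrt E) := by
  have h1 := abs_dispD_sub_dispDw_bump_le (β := β) hY hYM ha hN hQ.le hR.le hB hD₀ hD hγ hδ
  have h2 := norm_dispDw_bump_sub_mainTerm_le (a := a) (β := β) hY hYM N hQ.le hR.le hγ hδ H₀ hj K
  have h3 := norm_mainTerm_le a M Y N Q R β γ δ H₀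
  have h4 := norm_mainPlus_le hY hYM hN hQ hR β γ δ H₀ hT
    (fun ξ => hE _ (norm_deltaXi_le_one hR.le hT hδT ξ))
  have key : |dispDw a (mRange M Y) N Q R (fun m => bump M Y m) β γ δ| ≤
      ‖(dispDw a (mRange M Y) N Q R (fun m => bump M Y m) β γ δ : ℂ) -
          mainTerm a M Y N Q R β γ δ H₀‖ + ‖mainTerm a M Y N Q R β γ δ H₀‖ := by
    have e : |dispDw a (mRange M Y) N Q R (fun m => bump M Y m) β γ δ| =
        ‖(dispDw a (mRange M Y) N Q R (fun m => bump M Y m) β γ δ : ℂ)‖ := by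
      rw [Complex.norm_real, Real.norm_eq_abs]
    rw [e]
    exact norm_le_norm_sub_add _ _
  have habs : |dispD a M N Q R (fun _ => 1) β γ δ| ≤
      |dispD a M N Q R (fun _ => 1) β γ δ -
          dispDw a (mRange M Y) N Q R (fun m => bump M Y m) β γ δ| +
        |dispDw a (mRange M Y) N Q R (fun m => bump M Y m) β γ δ| := by
    have := abs_add_le (dispD a M N Q R (fun _ => 1) β γ δ -
      dispDw a (mRange M Y) N Q R (fun m => bump M Y m) β γ δ)
      (dispDw a (mRange M Y) N Q R (fun m => bump M Y m) β γ δ)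
    rwa [sub_add_cancel] at this
  linarith


end BFI

end Literature.NumberTheory.Sieve
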